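import Mathlib
import Literature.Analysis.Complex.CauchyTransform
import Literature.Analysis.Complex.CauchyTransformSupport
import Literature.Analysis.Complex.CauchyPompeiu
import Literature.Analysis.Complex.CauchyTransformHolderExtension
import Literature.Analysis.FunctionSpaces.ContDiffHolderSpace
import Literature.Analysis.FunctionSpaces.ContDiffHolderBilinear
import Literature.Analysis.FunctionSpaces.ContDiffHolderComposition
import Literature.Analysis.FunctionSpaces.ContDiffHolderClosedGraph
import Literature.Analysis.FunctionSpaces.ContDiffHolderDiffOperator
import Literature.Analysis.FunctionSpaces.ContDiffHolderLocalization
import Literature.Analysis.FunctionSpaces.ContDiffHolderMollify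
import Literature.Analysis.FunctionSpaces.ContDiffHolderCompactness
import Literature.Analysis.FunctionSpaces.ContDiffHolderOne

/-!
# CORE-A of crux `TameOrBrodyR4` (stmt-SmoothPoincare4-7826), line `Sketch`: the Cauchy transform as
# a bounded operator `C^{0,r}_b → C^{1,r}_b` on cut-off densities, and compactness of its cut-off
# zeroth-order perturbations (lead c6, assembly layer A1–A2)

Given the Hölder estimate for the Cauchy transform `T` (`Literature.Analysis.Complex`, T1a/T1b of
the line card; the a priori half taken as the named-fact hypothesis `hT : CauchyTransformHolderApriori F r` of
`Literature/Analysis/Complex/CauchyTransformHolderExtension.lean`, whose theorem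
`cauchyTransform_holder_of_apriori` turns it into the `C^{0,r}` statement), we bundle

* `cutTransformCLM hT χ' … : C^{0,r}_b(ℂ, F) →L[ℝ] C^{1,r}_b(ℂ, F)`, `g ↦ T (χ' • g)` for a smooth
  compactly supported cut-off `χ'` (membership from the estimate, continuity by closed graph);
* `IsCompactOperator` of `h ↦ χ • (M · T(χ' • h))` on `C^{0,r}_b` for smooth compactly supported
  `χ` and operator field `M` (Arzelà–Ascoli in `C^{1,r}_b` on the fixed compact support,
  `exists_subseq_tendstoUniformly_of_norm_le`, and `C¹`-convergence ⇒ `C^{0,r}`-norm convergence).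

Everything is proved; the analytic input enters only through `hT` (discharged by
`Literature.Analysis.Complex.cauchyTransform_holder_apriori` once T1a lands).
-/

-- the registered namespace `Summit.SmoothPoincare4.SmoothPoincare4.…` repeats a component
set_option linter.dupNamespace false

noncomputable section

open scoped ContDiff Topology NNReal
open Filter Set Metric Function Literature.Analysis.Complex Literature.Analysis.FunctionSpaces

namespace Summit.SmoothPoincare4.SmoothPoincare4.Cruxes.TameOrBrodyR4.Sketch

namespace CoreA

variable {F : Type} [NormedAddCommGroup F] [NormedSpace ℂ F] [CompleteSpace F] [FiniteDimensional ℂ F]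

variable {r : ℝ≥0}

/-! ### Elementary facts about members of `C^{0,r}_b` and `C^{1,r}_b` -/

omit [CompleteSpace F] [FiniteDimensional ℂ F] in
/-- The `r`-Hölder bound of a member of `C^{0,r}_b` in real form. -/
theorem norm_sub_le_norm_mul_rpow (g : ContDiffHolderFunction ℂ F 0 r) (z z' : ℂ) :
    ‖g z - g z'‖ ≤ ‖g‖ * ‖z - z'‖ ^ (r : ℝ) := by
  have h := (ContDiffHolderFunction.holderWith_of_zero g).dist_le_of_le (x := z) (y := z') le_rfl
  rw [dist_eq_norm, dist_eq_norm] at h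
  simpa using h

omit [CompleteSpace F] [FiniteDimensional ℂ F] in
/-- A cut-off density: `χ' • g` for `g ∈ C^{0,r}_b` and a smooth compactly supported real `χ'`
vanishes where `χ'` does. -/
theorem coeff_apply_eq_zero {χ' : ℂ → ℝ} (hχ' : ContDiff ℝ ∞ χ') (hχ's : HasCompactSupport χ')
    (hr : r ≤ 1) (g : ContDiffHolderFunction ℂ F 0 r) {z : ℂ} (hz : χ' z = 0) :
    ContDiffHolderFunction.coeffCLM hr χ' hχ' hχ's g z = 0 := by
  rw [ContDiffHolderFunction.coeffCLM_apply, hz, zero_smul]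

/-- A function vanishing off a bounded set has compact support (in `ℂ`). -/
theorem hasCompactSupport_of_eq_zero {G : Type*} [Zero G] [TopologicalSpace G] {f : ℂ → G} {ρ : ℝ}
    (hf : ∀ z, ρ ≤ ‖z‖ → f z = 0) : HasCompactSupport f := by
  refine HasCompactSupport.of_support_subset_isCompact (isCompact_closedBall (0 : ℂ) ρ) ?_
  intro z hz
  rw [mem_closedBall, dist_zero_right]
  by_contra h
  exact hz (hf z (le_of_lt (not_le.mp h)))

/-! ### The cut-off Cauchy transform as a bounded operator `C^{0,r}_b → C^{1,r}_b` -/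

section Transform

/-- **Membership**: for `g ∈ C^{0,r}_b`, the Cauchy transform of the cut-off density `χ' • g` is in
`C^{1,r}_b`, with `∂̄ T(χ' g) = χ' g`. -/
theorem memContDiffHolder_transform (hr0 : 0 < r) (hr1 : r < 1) (hT : CauchyTransformHolderApriori F r)
    {χ' : ℂ → ℝ} (hχ' : ContDiff ℝ ∞ χ') (hχ's : HasCompactSupport χ') {ρ : ℝ} (hρ : 0 < ρ)
    (hχ'ρ : ∀ z, ρ ≤ ‖z‖ → χ' z = 0) (g : ContDiffHolderFunction ℂ F 0 r) :
    MemContDiffHolder 1 r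
      (cauchyTransformAlong (1 : ℂ) (ContDiffHolderFunction.coeffCLM hr1.le χ' hχ' hχ's g)) ∧
    ∀ z, dbarAlong (1 : ℂ)
      (cauchyTransformAlong (1 : ℂ) (ContDiffHolderFunction.coeffCLM hr1.le χ' hχ' hχ's g)) z =
        ContDiffHolderFunction.coeffCLM hr1.le χ' hχ' hχ's g z := by
  set k := ContDiffHolderFunction.coeffCLM hr1.le χ' hχ' hχ's g with hk
  obtain ⟨C, hC0, hC⟩ := cauchyTransform_holder_of_apriori F hr0 hr1 hT ρ hρ
  have hkc : Continuous (k : ℂ → F) := k.continuous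
  have hkz : ∀ z, ρ ≤ ‖z‖ → k z = 0 := fun z hz => coeff_apply_eq_zero hχ' hχ's hr1.le g (hχ'ρ z hz)
  have hK₀ : ∀ z, ‖k z‖ ≤ ‖k‖ := fun z => k.norm_apply_le_norm z
  have hK₁ : ∀ z z', ‖k z - k z'‖ ≤ ‖k‖ * ‖z - z'‖ ^ (r : ℝ) := norm_sub_le_norm_mul_rpow k
  obtain ⟨h1, h2, h3, h4, h5⟩ :=
    hC k hkc hkz ‖k‖ ‖k‖ (norm_nonneg _) (norm_nonneg _) hK₀ hK₁
  refine ⟨?_, h2⟩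
  rw [memContDiffHolder_succ_iff]
  refine ⟨h1, eSupNorm_lt_top_iff.2 ⟨C * ‖k‖, h3⟩, ?_⟩
  have hcont : Continuous (fderiv ℝ (cauchyTransformAlong (1 : ℂ) (k : ℂ → F))) :=
    h1.continuous_fderiv one_ne_zero
  have hCK : 0 ≤ C * (‖k‖ + ‖k‖) := by positivity
  refine memContDiffHolder_zero_of_bounds hcont h4 (C := (C * (‖k‖ + ‖k‖)).toNNReal) ?_
  refine holderWith_of_dist_le fun z z' => ?_
  rw [dist_eq_norm, dist_eq_norm, Real.coe_toNNReal _ hCK]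
  exact h5 z z'

/-- The underlying linear map `g ↦ T(χ' • g)` into `C^{1,r}_b`. -/
def transformₗ (hr0 : 0 < r) (hr1 : r < 1) (hT : CauchyTransformHolderApriori F r)
    {χ' : ℂ → ℝ} (hχ' : ContDiff ℝ ∞ χ') (hχ's : HasCompactSupport χ') {ρ : ℝ} (hρ : 0 < ρ)
    (hχ'ρ : ∀ z, ρ ≤ ‖z‖ → χ' z = 0) :
    ContDiffHolderFunction ℂ F 0 r →ₗ[ℝ] ContDiffHolderFunction ℂ F 1 r where
  toFun g := ⟨cauchyTransformAlong (1 : ℂ) (ContDiffHolderFunction.coeffCLM hr1.le χ' hχ' hχ's g),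
    (memContDiffHolder_transform hr0 hr1 hT hχ' hχ's hρ hχ'ρ g).1⟩
  map_add' g g' := by
    apply ContDiffHolderFunction.ext
    intro z
    change cauchyTransformAlong 1
        (⇑(ContDiffHolderFunction.coeffCLM hr1.le χ' hχ' hχ's (g + g'))) z =
      cauchyTransformAlong 1 (⇑(ContDiffHolderFunction.coeffCLM hr1.le χ' hχ' hχ's g)) z +
        cauchyTransformAlong 1 (⇑(ContDiffHolderFunction.coeffCLM hr1.le χ' hχ' hχ's g')) z
    rw [map_add]
    rw [show (⇑(ContDiffHolderFunction.coeffCLM hr1.le χ' hχ' hχ's g +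
        ContDiffHolderFunction.coeffCLM hr1.le χ' hχ' hχ's g') : ℂ → F) =
        (ContDiffHolderFunction.coeffCLM hr1.le χ' hχ' hχ's g : ℂ → F) +
          (ContDiffHolderFunction.coeffCLM hr1.le χ' hχ' hχ's g' : ℂ → F) from rfl]
    exact cauchyTransformAlong_add (ContDiffHolderFunction.continuous _)
      (hasCompactSupport_of_eq_zero fun z hz => coeff_apply_eq_zero hχ' hχ's hr1.le g (hχ'ρ z hz))
      (ContDiffHolderFunction.continuous _)
      (hasCompactSupport_of_eq_zero fun z hz => coeff_apply_eq_zero hχ' hχ's hr1.le g' (hχ'ρ z hz))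
      one_ne_zero z
  map_smul' c g := by
    apply ContDiffHolderFunction.ext
    intro z
    change cauchyTransformAlong 1
        (⇑(ContDiffHolderFunction.coeffCLM hr1.le χ' hχ' hχ's (c • g))) z =
      c • cauchyTransformAlong 1 (⇑(ContDiffHolderFunction.coeffCLM hr1.le χ' hχ' hχ's g)) z
    rw [map_smul]
    rw [show (⇑(c • ContDiffHolderFunction.coeffCLM hr1.le χ' hχ' hχ's g) : ℂ → F) =
        (c : ℂ) • (ContDiffHolderFunction.coeffCLM hr1.le χ' hχ' hχ's g : ℂ → F) by
      funext w
      change c • (ContDiffHolderFunction.coeffCLM hr1.le χ' hχ' hχ's g) w = (c : ℂ) • _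
      exact (Complex.coe_smul c _).symm]
    rw [cauchyTransformAlong_const_smul, Complex.coe_smul]

/-- **The cut-off Cauchy transform** `g ↦ T(χ' • g)` as a bounded operator
`C^{0,r}_b(ℂ, F) →L[ℝ] C^{1,r}_b(ℂ, F)` (continuity by the closed graph theorem: point
evaluations are continuous by the sup bound). -/
def cutTransformCLM (hr0 : 0 < r) (hr1 : r < 1) (hT : CauchyTransformHolderApriori F r)
    {χ' : ℂ → ℝ} (hχ' : ContDiff ℝ ∞ χ') (hχ's : HasCompactSupport χ') {ρ : ℝ} (hρ : 0 < ρ)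
    (hχ'ρ : ∀ z, ρ ≤ ‖z‖ → χ' z = 0) :
    ContDiffHolderFunction ℂ F 0 r →L[ℝ] ContDiffHolderFunction ℂ F 1 r :=
  ContDiffHolderFunction.clmOfContinuousEval (transformₗ hr0 hr1 hT hχ' hχ's hρ hχ'ρ) fun z => by
    obtain ⟨C, hC0, hC⟩ := cauchyTransform_holder_of_apriori F hr0 hr1 hT ρ hρ
    -- the evaluation `g ↦ T(χ' g)(z)` is a linear map bounded by `C ‖χ'·‖ ‖g‖`
    let Lz : ContDiffHolderFunction ℂ F 0 r →ₗ[ℝ] F :=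
      { toFun := fun g => transformₗ hr0 hr1 hT hχ' hχ's hρ hχ'ρ g z
        map_add' := fun g g' => by rw [map_add]; rfl
        map_smul' := fun c g => by rw [map_smul]; rfl }
    set Mχ := (ContDiffHolderFunction.coeffCLM hr1.le χ' hχ' hχ's :
      ContDiffHolderFunction ℂ F 0 r →L[ℝ] ContDiffHolderFunction ℂ F 0 r) with hMχ
    have hLz : ∀ g, ‖Lz g‖ ≤ C * ‖Mχ‖ * ‖g‖ := by
      intro g
      set k := Mχ g
      have hkz : ∀ z, ρ ≤ ‖z‖ → k z = 0 := fun z hz =>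
        coeff_apply_eq_zero hχ' hχ's hr1.le g (hχ'ρ z hz)
      obtain ⟨-, -, h3, -, -⟩ := hC k k.continuous hkz ‖k‖ ‖k‖ (norm_nonneg _) (norm_nonneg _)
        (fun z => k.norm_apply_le_norm z) (norm_sub_le_norm_mul_rpow k)
      calc ‖Lz g‖ = ‖cauchyTransformAlong (1 : ℂ) (k : ℂ → F) z‖ := rfl
        _ ≤ C * ‖k‖ := h3 z
        _ ≤ C * (‖Mχ‖ * ‖g‖) := by gcongr; exact Mχ.le_opNorm g
        _ = C * ‖Mχ‖ * ‖g‖ := by ring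
    exact (Lz.mkContinuous _ hLz).continuous

/-- Pointwise formula for `cutTransformCLM`. -/
@[simp]
theorem cutTransformCLM_apply (hr0 : 0 < r) (hr1 : r < 1) (hT : CauchyTransformHolderApriori F r)
    {χ' : ℂ → ℝ} (hχ' : ContDiff ℝ ∞ χ') (hχ's : HasCompactSupport χ') {ρ : ℝ} (hρ : 0 < ρ)
    (hχ'ρ : ∀ z, ρ ≤ ‖z‖ → χ' z = 0) (g : ContDiffHolderFunction ℂ F 0 r) (z : ℂ) :
    cutTransformCLM hr0 hr1 hT hχ' hχ's hρ hχ'ρ g z =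
      cauchyTransformAlong (1 : ℂ) (ContDiffHolderFunction.coeffCLM hr1.le χ' hχ' hχ's g) z := rfl

/-- `∂̄` of the cut-off Cauchy transform returns the cut-off density. -/
theorem dbarAlong_cutTransformCLM (hr0 : 0 < r) (hr1 : r < 1)
    (hT : CauchyTransformHolderApriori F r) {χ' : ℂ → ℝ} (hχ' : ContDiff ℝ ∞ χ') (hχ's : HasCompactSupport χ') {ρ : ℝ}
    (hρ : 0 < ρ) (hχ'ρ : ∀ z, ρ ≤ ‖z‖ → χ' z = 0) (g : ContDiffHolderFunction ℂ F 0 r) (z : ℂ) :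
    dbarAlong (1 : ℂ) (cutTransformCLM hr0 hr1 hT hχ' hχ's hρ hχ'ρ g) z = χ' z • g z :=
  (memContDiffHolder_transform hr0 hr1 hT hχ' hχ's hρ hχ'ρ g).2 z

end Transform

/-! ### Compactness: `C^{1,r}_b`-bounded families with support in a fixed compact set are
relatively compact in `C^{0,r}_b` -/

section Compact

variable (hr0 : 0 < r) (hr1 : r ≤ 1)

include hr0 hr1 in
omit [CompleteSpace F] [FiniteDimensional ℂ F] in
/-- A `C¹` map with `‖φ‖ ≤ A` and `‖Dφ‖ ≤ D` is `r`-Hölder with constant `D + 2A` (`0 < r ≤ 1`). -/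
theorem norm_sub_le_of_fderiv_bound {φ : ℂ → F} (hφ : ContDiff ℝ 1 φ) {A D : ℝ} (hA0 : 0 ≤ A)
    (hD0 : 0 ≤ D) (hA : ∀ z, ‖φ z‖ ≤ A) (hD : ∀ z, ‖fderiv ℝ φ z‖ ≤ D) (z z' : ℂ) :
    ‖φ z - φ z'‖ ≤ (D + 2 * A) * ‖z - z'‖ ^ (r : ℝ) := by
  have hr0' : (0 : ℝ) < r := hr0
  have hr1' : (r : ℝ) ≤ 1 := hr1
  rcases le_or_gt ‖z - z'‖ 1 with h | h
  · have hmv : ‖φ z - φ z'‖ ≤ D * ‖z - z'‖ :=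
      (convex_univ).norm_image_sub_le_of_norm_fderiv_le (fun x _ => hφ.differentiable one_ne_zero x)
        (fun x _ => hD x) (mem_univ z') (mem_univ z)
    have hpow : ‖z - z'‖ ≤ ‖z - z'‖ ^ (r : ℝ) :=
      Real.self_le_rpow_of_le_one (norm_nonneg _) h hr1'
    calc ‖φ z - φ z'‖ ≤ D * ‖z - z'‖ := hmv
      _ ≤ D * ‖z - z'‖ ^ (r : ℝ) := by gcongr
      _ ≤ (D + 2 * A) * ‖z - z'‖ ^ (r : ℝ) := by gcongr; linarith
  · have hpow : (1 : ℝ) ≤ ‖z - z'‖ ^ (r : ℝ) := Real.one_le_rpow h.le hr0'.le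
    calc ‖φ z - φ z'‖ ≤ ‖φ z‖ + ‖φ z'‖ := norm_sub_le _ _
      _ ≤ 2 * A := by linarith [hA z, hA z']
      _ ≤ (D + 2 * A) * 1 := by linarith
      _ ≤ (D + 2 * A) * ‖z - z'‖ ^ (r : ℝ) := by gcongr

include hr0 in
omit [FiniteDimensional ℂ F] in
/-- **`C¹`-convergence implies `C^{0,r}`-norm convergence**: if `f n → g` and `D(f n) → Dg`
uniformly (`f n, g ∈ C^{1,r}_b`), then `f n → g` in the norm of `C^{0,r}_b`. -/
theorem tendsto_inclCLM_of_tendstoUniformly (f : ℕ → ContDiffHolderFunction ℂ F 1 r)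
    (g : ContDiffHolderFunction ℂ F 1 r)
    (h0 : TendstoUniformly (fun n => (f n : ℂ → F)) (g : ℂ → F) atTop)
    (h1 : TendstoUniformly (fun n => fderiv ℝ (f n : ℂ → F)) (fderiv ℝ (g : ℂ → F)) atTop) :
    Tendsto (fun n => ContDiffHolderFunction.inclCLM hr1 (f n) - ContDiffHolderFunction.inclCLM hr1 g)
      atTop (𝓝 0) := by
  rw [Metric.tendsto_nhds]
  intro ε hε
  have hε8 : 0 < ε / 8 := by positivity
  have e0 := (Metric.tendstoUniformly_iff.1 h0) (ε / 8) hε8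
  have e1 := (Metric.tendstoUniformly_iff.1 h1) (ε / 8) hε8
  filter_upwards [e0, e1] with n hn0 hn1
  rw [dist_zero_right]
  -- the difference as a `C¹` function with small sup norms of values and derivative
  set φ : ℂ → F := fun z => f n z - g z with hφ
  have hφc : ContDiff ℝ 1 φ := ((f n).contDiff).sub g.contDiff
  have hA : ∀ z, ‖φ z‖ ≤ ε / 8 := fun z => by
    have := hn0 z; rw [dist_eq_norm] at this
    simpa [hφ, norm_sub_rev] using this.le
  have hD : ∀ z, ‖fderiv ℝ φ z‖ ≤ ε / 8 := fun z => by
    have := hn1 z; rw [dist_eq_norm] at this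
    have hdf : fderiv ℝ φ z = fderiv ℝ (f n : ℂ → F) z - fderiv ℝ (g : ℂ → F) z :=
      fderiv_sub ((f n).contDiff.differentiable one_ne_zero z) (g.contDiff.differentiable one_ne_zero z)
    rw [hdf, norm_sub_rev]; exact this.le
  have hH := norm_sub_le_of_fderiv_bound hr0 hr1 hφc hε8.le hε8.le hA hD
  have hHW : HolderWith ((ε / 8 + 2 * (ε / 8))).toNNReal r φ := by
    refine holderWith_of_dist_le fun z z' => ?_
    rw [dist_eq_norm, dist_eq_norm, Real.coe_toNNReal _ (by positivity)]
    exact hH z z'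
  have hmem := ContDiffHolderFunction.norm_mk_le_of_bounds_zero (E := ℂ) (F := F) (r := r)
    hφc.continuous hA hHW
  have heq : ContDiffHolderFunction.inclCLM hr1 (f n) - ContDiffHolderFunction.inclCLM hr1 g =
      ⟨φ, memContDiffHolder_zero_of_bounds hφc.continuous hA hHW⟩ := by
    apply ContDiffHolderFunction.ext; intro z; rfl
  rw [heq]
  calc _ ≤ ε / 8 + ((ε / 8 + 2 * (ε / 8))).toNNReal := hmem
    _ = ε / 8 + (ε / 8 + 2 * (ε / 8)) := by rw [Real.coe_toNNReal _ (by positivity)]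
    _ < ε := by linarith

include hr0 in
/-- **Compactness**: a bounded operator `L : C^{0,r}_b → C^{1,r}_b` whose values are supported in a
fixed compact set becomes a COMPACT operator of `C^{0,r}_b` after the inclusion
`C^{1,r}_b ⊆ C^{0,r}_b` (Arzelà–Ascoli, `exists_subseq_tendstoUniformly_of_norm_le`). -/
theorem isCompactOperator_inclCLM_comp
    (L : ContDiffHolderFunction ℂ F 0 r →L[ℝ] ContDiffHolderFunction ℂ F 1 r) {K₀ : Set ℂ}
    (hK₀ : IsCompact K₀) (hL : ∀ h, tsupport (L h : ℂ → F) ⊆ K₀) :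
    IsCompactOperator ((ContDiffHolderFunction.inclCLM hr1).comp L) := by
  haveI : FiniteDimensional ℝ F := FiniteDimensional.complexToReal F
  set S : Set (ContDiffHolderFunction ℂ F 0 r) :=
    ((ContDiffHolderFunction.inclCLM hr1).comp L) '' closedBall 0 1 with hS
  -- every sequence in `S` has a subsequence converging in `C^{0,r}_b`
  have hseq : ∀ s : ℕ → ContDiffHolderFunction ℂ F 0 r, (∀ n, s n ∈ S) →
      ∃ a, ∃ φ : ℕ → ℕ, StrictMono φ ∧ Tendsto (s ∘ φ) atTop (𝓝 a) := by
    intro s hs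
    choose g hg hsg using hs
    have hB : ∀ n, ‖L (g n)‖ ≤ ‖L‖ := fun n => by
      calc ‖L (g n)‖ ≤ ‖L‖ * ‖g n‖ := L.le_opNorm _
        _ ≤ ‖L‖ * 1 := by gcongr; simpa using hg n
        _ = ‖L‖ := mul_one _
    obtain ⟨φ, hφ, G, hGs, hG⟩ :=
      exists_subseq_tendstoUniformly_of_norm_le hr0 hK₀ (fun n => L (g n)) hB (fun n => hL _)
    refine ⟨ContDiffHolderFunction.inclCLM hr1 G, φ, hφ, ?_⟩
    have h0 : TendstoUniformly (fun n => (L (g (φ n)) : ℂ → F)) (G : ℂ → F) atTop := by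
      have h := (continuousMultilinearCurryFin0 ℝ ℂ F).lipschitz.uniformContinuous.comp_tendstoUniformly
        (hG 0 (Nat.zero_le _))
      have e1 : (⇑(continuousMultilinearCurryFin0 ℝ ℂ F) ∘ iteratedFDeriv ℝ 0 (G : ℂ → F)) =
          (G : ℂ → F) := by
        funext z; simp
      have e2 : (fun i => ⇑(continuousMultilinearCurryFin0 ℝ ℂ F) ∘
          iteratedFDeriv ℝ 0 (L (g (φ i)) : ℂ → F)) = fun i => (L (g (φ i)) : ℂ → F) := by
        funext i z; simp
      rw [e1, e2] at h
      exact h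
    have h1 : TendstoUniformly (fun n => fderiv ℝ (L (g (φ n)) : ℂ → F)) (fderiv ℝ (G : ℂ → F))
        atTop := by
      have h := (continuousMultilinearCurryFin1 ℝ ℂ F).lipschitz.uniformContinuous.comp_tendstoUniformly
        (hG 1 le_rfl)
      have e1 : (⇑(continuousMultilinearCurryFin1 ℝ ℂ F) ∘ iteratedFDeriv ℝ 1 (G : ℂ → F)) =
          fderiv ℝ (G : ℂ → F) := by
        funext z
        rw [Function.comp_apply, iteratedFDeriv_one_eq_symm_comp_fderiv]
        simp
      have e2 : (fun i => ⇑(continuousMultilinearCurryFin1 ℝ ℂ F) ∘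
          iteratedFDeriv ℝ 1 (L (g (φ i)) : ℂ → F)) = fun i => fderiv ℝ (L (g (φ i)) : ℂ → F) := by
        funext i z
        rw [Function.comp_apply, iteratedFDeriv_one_eq_symm_comp_fderiv]
        simp
      rw [e1, e2] at h
      exact h
    have hlim := tendsto_inclCLM_of_tendstoUniformly hr0 hr1 (fun n => L (g (φ n))) G h0 h1
    have : (s ∘ φ) = fun n => ContDiffHolderFunction.inclCLM hr1 (L (g (φ n))) := by
      funext n; simp only [Function.comp_apply, ← hsg (φ n), ContinuousLinearMap.comp_apply]
    rw [this]
    have h' := hlim.add_const (ContDiffHolderFunction.inclCLM hr1 G)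
    simpa using h'
  -- the closure of `S` is sequentially compact, hence compact
  have hcl : IsCompact (closure S) := by
    rw [isCompact_iff_isSeqCompact]
    intro x hx
    -- approximate each `x n ∈ closure S` by `s n ∈ S` within `1/(n+1)`
    have hex : ∀ n, ∃ y ∈ S, dist (x n) y < 1 / ((n : ℝ) + 1) := fun n =>
      Metric.mem_closure_iff.1 (hx n) _ (by positivity)
    choose s hsS hds using hex
    obtain ⟨a, φ, hφ, ha⟩ := hseq s hsS
    refine ⟨a, ?_, φ, hφ, ?_⟩
    · exact mem_closure_of_tendsto ha (Eventually.of_forall fun n => hsS (φ n))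
    · -- `x ∘ φ` is asymptotic to `s ∘ φ`
      have hd : Tendsto (fun n => dist ((x ∘ φ) n) ((s ∘ φ) n)) atTop (𝓝 0) := by
        have h1n : Tendsto (fun n : ℕ => 1 / ((φ n : ℝ) + 1)) atTop (𝓝 0) :=
          (tendsto_one_div_add_atTop_nhds_zero_nat (𝕜 := ℝ)).comp hφ.tendsto_atTop
        exact squeeze_zero (fun n => dist_nonneg) (fun n => (hds (φ n)).le) h1n
      exact (tendsto_iff_of_dist hd).2 ha
  rw [isCompactOperator_iff_exists_mem_nhds_image_subset_compact]
  exact ⟨closedBall 0 1, Metric.closedBall_mem_nhds _ one_pos, closure S, hcl, subset_closure⟩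

end Compact

end CoreA

/-! ### Registered helpers (the two statements of this file consumed by the assembly) -/

/-- **Registered helper `helper_cutTransformPackage`**: given the a priori Hölder estimate for the
Cauchy transform (named fact `CauchyTransformHolderApriori`, T1a) and a smooth compactly
supported cut-off `χ'` vanishing off the disc of radius `ρ`, there is a bounded operator
`𝒯 : C^{0,r}_b(ℂ, F) →L[ℝ] C^{1,r}_b(ℂ, F)` with `𝒯 g = T(χ' • g)` pointwise and
`∂̄ (𝒯 g) = χ' • g`. -/
theorem helper_cutTransformPackage {F : Type} [NormedAddCommGroup F] [NormedSpace ℂ F]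
    [CompleteSpace F] [FiniteDimensional ℂ F] {r : ℝ≥0} (hr0 : 0 < r) (hr1 : r < 1)
    (hT : CauchyTransformHolderApriori F r) (χ' : ℂ → ℝ) (hχ' : ContDiff ℝ ∞ χ')
    (hχ's : HasCompactSupport χ') (ρ : ℝ) (hρ : 0 < ρ) (hχ'ρ : ∀ z, ρ ≤ ‖z‖ → χ' z = 0) :
    ∃ 𝒯 : ContDiffHolderFunction ℂ F 0 r →L[ℝ] ContDiffHolderFunction ℂ F 1 r,
      (∀ (g : ContDiffHolderFunction ℂ F 0 r) (z : ℂ),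
        𝒯 g z = cauchyTransformAlong (1 : ℂ) (fun w => χ' w • g w) z) ∧
      (∀ (g : ContDiffHolderFunction ℂ F 0 r) (z : ℂ), dbarAlong (1 : ℂ) (𝒯 g) z = χ' z • g z) :=
  ⟨CoreA.cutTransformCLM hr0 hr1 hT hχ' hχ's hρ hχ'ρ, fun _ _ => rfl,
    CoreA.dbarAlong_cutTransformCLM hr0 hr1 hT hχ' hχ's hρ hχ'ρ⟩

/-- **Registered helper `helper_compactInclusion`**: a bounded operator
`C^{0,r}_b(ℂ, F) →L[ℝ] C^{1,r}_b(ℂ, F)` with values supported in a fixed compact set becomes a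
compact operator of `C^{0,r}_b(ℂ, F)` after the inclusion `C^{1,r}_b ⊆ C^{0,r}_b`. -/
theorem helper_compactInclusion {F : Type} [NormedAddCommGroup F] [NormedSpace ℂ F]
    [CompleteSpace F] [FiniteDimensional ℂ F] {r : ℝ≥0} (hr0 : 0 < r) (hr1 : r ≤ 1)
    (L : ContDiffHolderFunction ℂ F 0 r →L[ℝ] ContDiffHolderFunction ℂ F 1 r) (K₀ : Set ℂ)
    (hK₀ : IsCompact K₀) (hL : ∀ h, tsupport (L h : ℂ → F) ⊆ K₀) :
    IsCompactOperator ((ContDiffHolderFunction.inclCLM hr1).comp L) :=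
  CoreA.isCompactOperator_inclCLM_comp hr0 hr1 L hK₀ hL



end Summit.SmoothPoincare4.SmoothPoincare4.Cruxes.TameOrBrodyR4.Sketch
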